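import Mathlib
import HarnessLib
import Summits.HubbardSuperconductivity.HubbardSuperconductivity.Theorems.KLProgrammeKLRegimeSplitEngineV9
import Summits.HubbardSuperconductivity.HubbardSuperconductivity.Theorems.KLProgrammeKLRegimeSplitBundleV13

/-!
# Route `KLProgramme` — crux K3 `KLRegimeTwoPointLimit` (stmt-HubbardSuperconductivity-19937): the GEN-5 bundle
# `klPredsV14` = V13 (Δ23, function pieces) with the engine slot `EngineBoundsAtV9S` (Δ24 / E2-DRIVE) and the two-leg slot THINNED to its
# consumed conjuncts ((R11) census; cell gate-hubbard-kl, seat p2 g7 = bundle typist; plan g12 WORD (R12′)/(R13) STATUS l.1608 2026-08-27T02:02:44Z,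
# l.1629 02:13:06Z, (R11) census l.1597 01:57:14Z → ruling l.1675 02:40:03Z «ALL THREE DROPPED; text of record = this draft»; plan2 g4 kit V14 l.1633/l.1671)

Δ24 / E2-DRIVE (finder k3c1-p1 g4 `HOME/hubbard-kl-k3c1-p1/E2-DRIVE-FINDING.md`, STATUS l.1599; confirmed by the clause author p1 g8 l.1607 and the
typing authority l.1608/l.1611; module `…SplitEngineV9`, p1 g8 p488021): (E2-v8)'s `1 ≤ n` budget omits the two particle–hole gains at the
direct/crossed transfers `|k − k′|_𝕋`, `|k + k′ − Qm|_𝕋` (the forward-exchange instance has `phGain = 1`, an `n`-independent `≈ 0.2·N₀U²` source the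
`(k,k′)`-flat ladder correction cannot absorb) ⇒ false as typed deep inside `β ≤ e^{c/U²}`; (E2-v9) := (E2-v8) + (X)
`+ (P.Klam·U)²·(G.phGain n |k − k′|_𝕋 + G.phGain n |k + k′ − Qm|_𝕋)`, everything else verbatim; `EngineBoundsAtV9S` = V8S with that one conjunct,
ORDER KEPT; `EngineBoundsAtV8S ⇒ EngineBoundsAtV9S` under `G.WF` (`engineBoundsAtV9S_of_V8S`) — so EVERY V8-keyed supplier and every V12/V13
history lifts (`histV14_of_histV12` below); at scale `0` the slots coincide (`histV14_iff_histV12_zero`).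

THE TWO-LEG SLOT `TwoLegStepV14` — V13's (function pieces `klTwoLegPieceFn … K.eval n`, (D1)–(D5) of `…SplitBundleV13` p484180 by reference)
read at the V14 history `histV14 := BetaSplitAtS2 ∧ RenormalisedAtF ∧ EngineBoundsAtV9S`, with
(D6) (R11) DROPS — (α) `TwoLegSizesFn` conjunct 3 (tier 2, `j ≤ 4` under the depth-`n` guard `FrameOKFn R U n μ K.eval`), (β) `TwoLegFloorFn`
     (E3b), (γ) `TwoLegAngularG` (E3g) (+ its copy in the (E3f) rate antecedent) are NOT slot clauses of gen 5: no consumer in any child (census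
     STATUS l.1597 → ruling l.1675 (D1): every registrant / closer author answered NOT READ); suppliers keep their closers as reserve
     (`twoLegFloorFn_of_sizes`, `twoLegAngularG_of_graded_sizes(_explicit)`, tier-2 accessors); a later generation re-adds a clause only WITH a named
     consumer (rider rule).  A drop is a pure weakening of `Pr.twoLeg` — no new clause, carrier or numeral.  What child 2's landed chain reads stays,
     LITERALLY: the T1 sizes pair `ContDiff ℝ 4 (onM piece) ∧ (∀ j ≤ 2, ∀ q, ‖Dʲ(onM piece) q‖ ≤ twoLegBar j n)` (= conjuncts 1–2 of
     `TwoLegSizesFn … K.eval n`, C⁴ first, tier 1 second — k3c3-p2 l.1650, `…CountertermContinuationJT`/`…OneVolumeJT`), (E3c-T) `FrameLipschitzFnT histV14`,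
     (E3d/e) `TwoLegSlopes`, (E3a-MS-T) `TwoLegSizesMST`, (E3f) `TwoLegVolumeRate` with antecedent «`histV14` ∧ the same thin step ∧ `TwoLegSizesMST`» at
     the comparison volume.
Shape: `TwoLegStepV14 … K n := TwoLegCoreT histV14 … K n ∧ TwoLegSizesMST … K n ∧ TwoLegVolumeRate (histV14 ∧ TwoLegCoreT histV14 ∧
TwoLegSizesMST) Q β U μ K n` with `TwoLegCoreT hist := TwoLegSizesT1Fn ∧ FrameLipschitzFnT hist ∧ TwoLegSlopes` (= `TwoLegStepT hist` minus
tier 2 and the floor: `twoLegCoreT_of_twoLegStepT`).  NOTE ON (E3c): `FrameLipschitzFnT` is ANTITONE in the history token — `histV12 ⇒ histV14`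
makes the V14 Lipschitz clause range over MORE comparison frames than V13's (`frameLipschitzFnT_anti`, `twoLegCoreT_histV12_of_histV14`).

UNCHANGED: `Preds`, GenericV4, GlueP4, `FrameOK`, `RenormalisedAtF`, `BetaSplitAtS2`, every `∀ K : TrigPolyC4v` binder, `EngineP4`'s `∃ L₃ M₃`
before `∀ K` (plan g12 (R6)), all numerals.  Contents: §1 `histV14`, `TwoLegSizesT1Fn`, `TwoLegCoreT`, `TwoLegStepV14`, `klPredsV14 : Preds`
as a LITERAL; §2 `rfl` bookkeeping (field-wise `rfl` to `klPredsV12` outside `engine`/`twoLeg`) + the accessor interface child 2 / the T3–T4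
registrants cite (`twoLegCoreT_of_twoLegStepV14`, `TwoLegCoreT.sizes/.contDiff/.tier1/.lipschitz/.slopes`, `twoLegSizesMST_of_twoLegStepV14`,
`histV14_of_histP_V14`, `histRateV14_of_histP`, `twoLegVolumeRate_apply_of_V14`); §3 bridges (V12/V13 history ⇒ V14 history; scale `0`; thin ⇐ T).
Children of gen 5: `EngineP4 | BetaSplitP | CountertermP2 | VolumeLimitP2 (FinalTwoLegVolLimitEx) | TwoPointAssemblyP3 (FinalTwoLegVolLimitEx)` on
`klPredsV14 klWindowC`.  Definitions (+ bookkeeping) only; nothing about the model is asserted; no engine stub is proved here; nothing asserts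
superconductivity.
-/

noncomputable section

namespace Summit.HubbardSuperconductivity.HubbardSuperconductivity.Theorems.KLRegimeSplit

set_option linter.dupNamespace false -- summit = problem name (single-conjunct summit), D-0017

open Real Finset Literature.MathematicalPhysics.QuantumLattice Literature.Probability.LatticeModels
open Literature.MathematicalPhysics.QuantumLattice.FermiRG
open Summit.HubbardSuperconductivity.HubbardSuperconductivity.Theorems.KLProgrammeLegKernels

/-! ## §1 The V14 history, the thin two-leg step, the two-leg slot and the bundle -/

section Model

variable (L M : ℕ) [NeZero L] [NeZero M]

/-- **The comparison-frame / comparison-volume history of the V14 bundle** at scale `j`: `BetaSplitAtS2 ∧ RenormalisedAtF ∧ EngineBoundsAtV9S`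
(= this bundle's `split ∧ renorm ∧ engine`, so `HistP klPredsV14` discharges it at any volume: `histV14_of_histP_V14`). -/
def histV14 (G : GeoConsts) (P : SplitConsts) (Q : EngConsts) (R : RenConsts) (β U μ : ℝ) : TrigPolyC4v → ℕ → Prop :=
  fun K' j => BetaSplitAtS2 L M G P Q β U μ K' j ∧ RenormalisedAtF L M β U μ K' R j ∧ EngineBoundsAtV9S L M G P Q β U μ K' j

/-- **(E3a-T1)** the CONSUMED sizes of the scale-`n` function piece: `C⁴` on `Momentum` and tier 1 (`j ≤ 2`, every admissible frame, no
guard) — LITERALLY conjuncts 1–2 of `TwoLegSizesFn … K n` (p479563; tier 2 = conjunct 3, (α), dropped by (R11)); `FrameFn` carrier, read at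
`K.eval` by `TwoLegCoreT` (the pair k3c3-p2's `…JT` chain reads, C⁴ first, tier 1 second). -/
def TwoLegSizesT1Fn (G : GeoConsts) (Q : EngConsts) (β U μ : ℝ) (K : FrameFn) (n : ℕ) : Prop :=
  ContDiff ℝ 4 (onM (klTwoLegPieceFn L M β U μ K n)) ∧
  (∀ j ≤ 2, ∀ q : Momentum, ‖iteratedFDeriv ℝ j (onM (klTwoLegPieceFn L M β U μ K n)) q‖ ≤ twoLegBar G Q U j n)

/-- **`TwoLegCoreT hist … K n`** := (E3a-T1) at `K.eval` ∧ (E3c-T) `FrameLipschitzFnT hist` ∧ (E3d/e) `TwoLegSlopes` — `TwoLegStepT hist`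
(p482731) with tier 2 of (E3a) and the floor (E3b) dropped ((R11) (α)/(β)); `P` carried for slot-shape uniformity. -/
def TwoLegCoreT (hist : TrigPolyC4v → ℕ → Prop) (G : GeoConsts) (_P : SplitConsts) (Q : EngConsts) (R : RenConsts)
    (β U μ : ℝ) (K : TrigPolyC4v) (n : ℕ) : Prop :=
  TwoLegSizesT1Fn L M G Q β U μ K.eval n ∧ FrameLipschitzFnT L M hist G Q R β U μ K n ∧ TwoLegSlopes L M R β U μ K n

/-- **`TwoLegStepV14 … G P Q R K n`** := `TwoLegCoreT histV14 ∧ TwoLegSizesMST ∧ TwoLegVolumeRate (histV14 ∧ TwoLegCoreT histV14 ∧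
TwoLegSizesMST)` — V13's two-leg slot read at the V14 history with (α) tier 2, (β) floor, (γ) angular regularity DROPPED (unconsumed, (R11)).
Same slot type as `Preds.twoLeg`. -/
def TwoLegStepV14 (G : GeoConsts) (P : SplitConsts) (Q : EngConsts) (R : RenConsts) (β U μ : ℝ) (K : TrigPolyC4v) (n : ℕ) :
    Prop :=
  TwoLegCoreT L M (histV14 L M G P Q R β U μ) G P Q R β U μ K n ∧ TwoLegSizesMST L M G Q R β U μ K n ∧
    TwoLegVolumeRate L M
      (fun L' M' _ _ K' j => histV14 L' M' G P Q R β U μ K' j ∧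
        TwoLegCoreT L' M' (histV14 L' M' G P Q R β U μ) G P Q R β U μ K' j ∧ TwoLegSizesMST L' M' G Q R β U μ K' j)
      Q β U μ K n

end Model

/-- **`klPredsV14 : Preds`** — the LITERAL `{ frameOK := FrameOK, renorm := RenormalisedAtF, split := BetaSplitAtS2, engine := EngineBoundsAtV9S,
twoLeg := TwoLegStepV14 }` (field-wise `rfl` to `klPredsV12`/`klPredsV13` outside `engine`/`twoLeg`, §2).  Children of gen 5:
`EngineP4 | BetaSplitP | CountertermP2 | VolumeLimitP2 (FinalTwoLegVolLimitEx) | TwoPointAssemblyP3 (FinalTwoLegVolLimitEx)` on `klPredsV14 klWindowC`. -/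
def klPredsV14 : Preds where
  frameOK := FrameOK
  renorm := fun L M _ _ β U μ K R n => RenormalisedAtF L M β U μ K R n
  split := fun L M _ _ G P Q β U μ K n => BetaSplitAtS2 L M G P Q β U μ K n
  engine := fun L M _ _ G P Q β U μ K n => EngineBoundsAtV9S L M G P Q β U μ K n
  twoLeg := fun L M _ _ G P Q R β U μ K n => TwoLegStepV14 L M G P Q R β U μ K n

/-! ## §2 Bookkeeping (`rfl`-level) and the accessor interface -/

/-- V14's frame class IS V12's (`FrameOK`). -/
theorem klPredsV14_frameOK : klPredsV14.frameOK = klPredsV12.frameOK := rfl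

/-- V14's renormalisation slot IS V12's. -/
theorem klPredsV14_renorm : klPredsV14.renorm = klPredsV12.renorm := rfl

/-- V14's split slot IS V12's. -/
theorem klPredsV14_split : klPredsV14.split = klPredsV12.split := rfl

/-- V14's frame class IS V13's. -/
theorem klPredsV14_frameOK_V13 : klPredsV14.frameOK = klPredsV13.frameOK := rfl

/-- V14's renormalisation slot IS V13's. -/
theorem klPredsV14_renorm_V13 : klPredsV14.renorm = klPredsV13.renorm := rfl

/-- V14's split slot IS V13's. -/
theorem klPredsV14_split_V13 : klPredsV14.split = klPredsV13.split := rfl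

/-- V14's engine slot, applied: `EngineBoundsAtV9S`. -/
theorem klPredsV14_engine_apply (L M : ℕ) [NeZero L] [NeZero M] (G : GeoConsts) (P : SplitConsts) (Q : EngConsts) (β U μ : ℝ)
    (K : TrigPolyC4v) (n : ℕ) : klPredsV14.engine L M G P Q β U μ K n = EngineBoundsAtV9S L M G P Q β U μ K n := rfl

/-- V14's split slot, applied. -/
theorem klPredsV14_split_apply (L M : ℕ) [NeZero L] [NeZero M] (G : GeoConsts) (P : SplitConsts) (Q : EngConsts) (β U μ : ℝ)
    (K : TrigPolyC4v) (n : ℕ) : klPredsV14.split L M G P Q β U μ K n = BetaSplitAtS2 L M G P Q β U μ K n := rfl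

/-- V14's renormalisation slot, applied. -/
theorem klPredsV14_renorm_apply (L M : ℕ) [NeZero L] [NeZero M] (β U μ : ℝ) (K : TrigPolyC4v) (R : RenConsts) (n : ℕ) :
    klPredsV14.renorm L M β U μ K R n = RenormalisedAtF L M β U μ K R n := rfl

/-- V14's frame class is `FrameOK`. -/
theorem klPredsV14_frameOK_apply : klPredsV14.frameOK = FrameOK := rfl

/-- V14's two-leg slot is `TwoLegStepV14`. -/
theorem klPredsV14_twoLeg (L M : ℕ) [NeZero L] [NeZero M] (G : GeoConsts) (P : SplitConsts) (Q : EngConsts) (R : RenConsts)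
    (β U μ : ℝ) (K : TrigPolyC4v) (n : ℕ) :
    klPredsV14.twoLeg L M G P Q R β U μ K n = TwoLegStepV14 L M G P Q R β U μ K n := rfl

/-- The V14 history unfolds to its three slots. -/
theorem histV14_eq (L M : ℕ) [NeZero L] [NeZero M] (G : GeoConsts) (P : SplitConsts) (Q : EngConsts) (R : RenConsts) (β U μ : ℝ)
    (K : TrigPolyC4v) (j : ℕ) :
    histV14 L M G P Q R β U μ K j =
      (BetaSplitAtS2 L M G P Q β U μ K j ∧ RenormalisedAtF L M β U μ K R j ∧ EngineBoundsAtV9S L M G P Q β U μ K j) := rfl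

section Model

variable {L M : ℕ} [NeZero L] [NeZero M] {G : GeoConsts} {P : SplitConsts} {Q : EngConsts} {R : RenConsts} {β U μ : ℝ}
  {K : TrigPolyC4v} {n : ℕ}

/-- The thin sizes pair of `TwoLegCoreT` (`C⁴` ∧ tier 1 — the block child 2's `…JT` chain reads). -/
theorem TwoLegCoreT.sizes {hist : TrigPolyC4v → ℕ → Prop} (h : TwoLegCoreT L M hist G P Q R β U μ K n) :
    ContDiff ℝ 4 (onM (klTwoLegPieceFn L M β U μ K.eval n)) ∧
      ∀ j ≤ 2, ∀ q : Momentum, ‖iteratedFDeriv ℝ j (onM (klTwoLegPieceFn L M β U μ K.eval n)) q‖ ≤ twoLegBar G Q U j n := h.1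

/-- The named form of the thin sizes pair. -/
theorem TwoLegCoreT.sizesT1 {hist : TrigPolyC4v → ℕ → Prop} (h : TwoLegCoreT L M hist G P Q R β U μ K n) :
    TwoLegSizesT1Fn L M G Q β U μ K.eval n := h.1

/-- The function piece is `C⁴` on `Momentum`. -/
theorem TwoLegCoreT.contDiff {hist : TrigPolyC4v → ℕ → Prop} (h : TwoLegCoreT L M hist G P Q R β U μ K n) :
    ContDiff ℝ 4 (onM (klTwoLegPieceFn L M β U μ K.eval n)) := h.1.1

/-- Tier 1 (`j ≤ 2`) for every admissible frame, no guard. -/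
theorem TwoLegCoreT.tier1 {hist : TrigPolyC4v → ℕ → Prop} (h : TwoLegCoreT L M hist G P Q R β U μ K n) {j : ℕ} (hj : j ≤ 2)
    (q : Momentum) : ‖iteratedFDeriv ℝ j (onM (klTwoLegPieceFn L M β U μ K.eval n)) q‖ ≤ twoLegBar G Q U j n := h.1.2 j hj q

/-- The Lipschitz conjunct (E3c-T). -/
theorem TwoLegCoreT.lipschitz {hist : TrigPolyC4v → ℕ → Prop} (h : TwoLegCoreT L M hist G P Q R β U μ K n) :
    FrameLipschitzFnT L M hist G Q R β U μ K n := h.2.1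

/-- The slopes conjunct (E3d/e) (today's text). -/
theorem TwoLegCoreT.slopes {hist : TrigPolyC4v → ℕ → Prop} (h : TwoLegCoreT L M hist G P Q R β U μ K n) :
    TwoLegSlopes L M R β U μ K n := h.2.2

/-- The (E3d/e) slopes in the Fn spelling (same statement, `twoLegSlopesFn_eval_iff`). -/
theorem TwoLegCoreT.slopesFn {hist : TrigPolyC4v → ℕ → Prop} (h : TwoLegCoreT L M hist G P Q R β U μ K n) :
    TwoLegSlopesFn L M R β U μ K.eval n := (twoLegSlopesFn_eval_iff L M R β U μ K n).mpr h.2.2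

/-- Assemble a thin step from its three conjuncts. -/
theorem twoLegCoreT_of_conjuncts {hist : TrigPolyC4v → ℕ → Prop} (hs : TwoLegSizesT1Fn L M G Q β U μ K.eval n)
    (hl : FrameLipschitzFnT L M hist G Q R β U μ K n) (hsl : TwoLegSlopes L M R β U μ K n) : TwoLegCoreT L M hist G P Q R β U μ K n :=
  ⟨hs, hl, hsl⟩

/-- The thin two-leg step (at the V14 history) is the first conjunct of the V14 slot. -/
theorem twoLegCoreT_of_twoLegStepV14 (h : TwoLegStepV14 L M G P Q R β U μ K n) :
    TwoLegCoreT L M (histV14 L M G P Q R β U μ) G P Q R β U μ K n := h.1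

/-- (E3a-MS-T) is the second conjunct of the V14 slot. -/
theorem twoLegSizesMST_of_twoLegStepV14 (h : TwoLegStepV14 L M G P Q R β U μ K n) : TwoLegSizesMST L M G Q R β U μ K n := h.2.1

/-- The volume-rate conjunct (E3f) with its V14 antecedent. -/
theorem twoLegVolumeRate_of_twoLegStepV14 (h : TwoLegStepV14 L M G P Q R β U μ K n) :
    TwoLegVolumeRate L M
      (fun L' M' _ _ K' j => histV14 L' M' G P Q R β U μ K' j ∧
        TwoLegCoreT L' M' (histV14 L' M' G P Q R β U μ) G P Q R β U μ K' j ∧ TwoLegSizesMST L' M' G Q R β U μ K' j)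
      Q β U μ K n := h.2.2

/-- Assemble the V14 slot from its three conjuncts (the engine's two-leg stubs deliver it in this shape). -/
theorem twoLegStepV14_of_conjuncts (h1 : TwoLegCoreT L M (histV14 L M G P Q R β U μ) G P Q R β U μ K n)
    (h2 : TwoLegSizesMST L M G Q R β U μ K n)
    (h3 : TwoLegVolumeRate L M
      (fun L' M' _ _ K' j => histV14 L' M' G P Q R β U μ K' j ∧
        TwoLegCoreT L' M' (histV14 L' M' G P Q R β U μ) G P Q R β U μ K' j ∧ TwoLegSizesMST L' M' G Q R β U μ K' j)
      Q β U μ K n) :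
    TwoLegStepV14 L M G P Q R β U μ K n := ⟨h1, h2, h3⟩

/-- **`HistP klPredsV14` below `n` yields the V14 history**: `histV14 … K j` for every `j < n` (plan2 kit name). -/
theorem histV14_of_histP_V14 (h : HistP klPredsV14 L M G P Q R β U μ K n) : ∀ j < n, histV14 L M G P Q R β U μ K j :=
  fun j hj => ⟨(h j hj).1, (h j hj).2.1, (h j hj).2.2.1⟩

/-- `HistP klPredsV14` below `n` yields the full (E3f) antecedent of V14 at that volume. -/
theorem histRateV14_of_histP (h : HistP klPredsV14 L M G P Q R β U μ K n) :
    ∀ j < n, histV14 L M G P Q R β U μ K j ∧ TwoLegCoreT L M (histV14 L M G P Q R β U μ) G P Q R β U μ K j ∧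
      TwoLegSizesMST L M G Q R β U μ K j := fun j hj =>
  ⟨⟨(h j hj).1, (h j hj).2.1, (h j hj).2.2.1⟩, (h j hj).2.2.2.1, (h j hj).2.2.2.2.1⟩

/-- **V14's rate clause applies whenever the comparison volume carries the V14 history** (child 2's one-liner). -/
theorem twoLegVolumeRate_apply_of_V14 (h : TwoLegStepV14 L M G P Q R β U μ K n) (hM : Q.M0 β L ≤ M) {L' M' : ℕ} [NeZero L']
    [NeZero M'] (hL : L ≤ L') (hM' : Q.M0 β L' ≤ M') (hhist : HistP klPredsV14 L' M' G P Q R β U μ K n) (θ : ℝ) :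
    |klLocalPart L M β U μ K n θ - klLocalPart L' M' β U μ K n θ| ≤ Q.CL β n / L :=
  h.2.2 hM L' M' hL hM' (histRateV14_of_histP hhist) θ

/-- Tier-1 sizes of the function piece straight from the V14 slot. -/
theorem norm_iteratedFDeriv_pieceFn_le_of_V14 (h : TwoLegStepV14 L M G P Q R β U μ K n) {j : ℕ} (hj : j ≤ 2) (q : Momentum) :
    ‖iteratedFDeriv ℝ j (onM (klTwoLegPieceFn L M β U μ K.eval n)) q‖ ≤ twoLegBar G Q U j n :=
  h.1.tier1 hj q

/-- **(E2-v9), scale `0`** — named accessor (child 1 / the bridge instance cite this, not a positional path): the UV deviation of the pair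
amplitude from `U` on the ball. -/
theorem PairLadderStepAtV9.zero (h : PairLadderStepAtV9 L M G P Q β U μ K n) (hn : n = 0) (Qm : TorusSite 2 L) {k k' : TorusSite 2 L}
    (hk : k ∈ klBall L μ K) (hk' : k' ∈ klBall L μ K) :
    ‖klPairAmplitude L M β U μ K 0 Qm k k' - (U : ℂ)‖ ≤ initDevBar G U + legDressBarQ G P Q U 0 4 := h.1 hn Qm k hk k' hk'

/-- **(E2-v9), scales `1 ≤ n`** — named accessor: for a pair class `Qm`, the signed slice weights with their mass / negative-mass edge bounds,
a right inverse of `1 + diag(w)·𝒞_{n−1}(Qm)`, and the entrywise budget INCLUDING the two crossed particle–hole gains (X). -/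
theorem PairLadderStepAtV9.step (h : PairLadderStepAtV9 L M G P Q β U μ K n) (hn : 1 ≤ n) (Qm : TorusSite 2 L)
    (hQ : IsPairClassAt L Qm n) :
    ∃ w : TorusSite 2 L → ℝ, (∑ p, |w p| ≤ G.bhi) ∧ (∑ p, (|w p| - w p) ≤ 2 * klEdge G n (klTorusNorm L Qm)) ∧
      ∃ N : Matrix (TorusSite 2 L) (TorusSite 2 L) ℂ,
        (1 + Matrix.diagonal (fun p => (w p : ℂ)) * klPairArray L M β U μ K (n - 1) Qm) * N = 1 ∧
        ∀ k ∈ klBall L μ K, ∀ k' ∈ klBall L μ K,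
          ‖klPairAmplitude L M β U μ K n Qm k k' - (klPairArray L M β U μ K (n - 1) Qm * N) k k'‖ ≤
            drivePBar G P U (n - 1) + eremBar G P Q U β L (n - 1) + thermalBar G P U β n +
              legDressBarQ G P Q U n (legSliceCountT L β μ K n ![k', Qm - k', Qm - k, k]) +
              (P.Klam * U) ^ 2 * (G.phGain n (klTorusNorm L (k - k')) + G.phGain n (klTorusNorm L (k + k' - Qm))) :=
  h.2 hn Qm hQ

/-- (E2-v9) straight from the V14 history at `j` (`.2.2` then `.2.2.1`, named). -/
theorem pairLadderStepAtV9_of_histV14 {j : ℕ} (h : histV14 L M G P Q R β U μ K j) : PairLadderStepAtV9 L M G P Q β U μ K j := h.2.2.2.2.1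

/-- The engine slot of the V14 history at `j`. -/
theorem engineBoundsAtV9S_of_histV14 {j : ℕ} (h : histV14 L M G P Q R β U μ K j) : EngineBoundsAtV9S L M G P Q β U μ K j := h.2.2

/-- The split slot of the V14 history at `j`. -/
theorem betaSplitAtS2_of_histV14 {j : ℕ} (h : histV14 L M G P Q R β U μ K j) : BetaSplitAtS2 L M G P Q β U μ K j := h.1

/-- The renormalisation slot of the V14 history at `j`. -/
theorem renormalisedAtF_of_histV14 {j : ℕ} (h : histV14 L M G P Q R β U μ K j) : RenormalisedAtF L M β U μ K R j := h.2.1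

/-- `HistP klPredsV14` at `j < n`, destructured into the four slots by `rfl`. -/
theorem histP_V14_apply (h : HistP klPredsV14 L M G P Q R β U μ K n) {j : ℕ} (hj : j < n) :
    BetaSplitAtS2 L M G P Q β U μ K j ∧ RenormalisedAtF L M β U μ K R j ∧ EngineBoundsAtV9S L M G P Q β U μ K j ∧
      TwoLegStepV14 L M G P Q R β U μ K j := h j hj

end Model

/-! ## §3 Bridges: V12/V13 histories lift to V14; scale `0`; thin ⇐ T; (E3c) is antitone in the history -/

section Bridge

variable {L M : ℕ} [NeZero L] [NeZero M] {G : GeoConsts} {P : SplitConsts} {Q : EngConsts} {R : RenConsts} {β U μ : ℝ}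
  {K : TrigPolyC4v}

/-- **A V12 (= V13) history is a V14 history** (for `G.WF`, which gives `0 ≤ phGain`): `engineBoundsAtV9S_of_V8S` on the engine conjunct. -/
theorem histV14_of_histV12 (hG : G.WF) {j : ℕ} (h : histV12 L M G P Q R β U μ K j) : histV14 L M G P Q R β U μ K j :=
  ⟨h.1, h.2.1, engineBoundsAtV9S_of_V8S hG h.2.2⟩

/-- **At scale `0` the V14 and V12 histories COINCIDE** ((X) lives in the `1 ≤ n` conjunct of (E2)). -/
theorem histV14_iff_histV12_zero : histV14 L M G P Q R β U μ K 0 ↔ histV12 L M G P Q R β U μ K 0 := by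
  simp only [histV14, histV12, engineBoundsAtV9S_iff_V8S_zero]

/-- **(E3c-T) is ANTITONE in the history token**: a Lipschitz clause against every comparison frame with history `hist₂` is one against every
comparison frame with a STRONGER history `hist₁ ⇒ hist₂`. -/
theorem frameLipschitzFnT_anti {hist₁ hist₂ : TrigPolyC4v → ℕ → Prop} (hh : ∀ K' j, hist₁ K' j → hist₂ K' j) {n : ℕ}
    (h : FrameLipschitzFnT L M hist₂ G Q R β U μ K n) : FrameLipschitzFnT L M hist₁ G Q R β U μ K n :=
  fun K' hK' hh' q => h K' hK' (fun j hj => hh K' j (hh' j hj)) q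

/-- The thin step is antitone in the history token (through (E3c-T)). -/
theorem twoLegCoreT_anti {hist₁ hist₂ : TrigPolyC4v → ℕ → Prop} (hh : ∀ K' j, hist₁ K' j → hist₂ K' j) {n : ℕ}
    (h : TwoLegCoreT L M hist₂ G P Q R β U μ K n) : TwoLegCoreT L M hist₁ G P Q R β U μ K n :=
  ⟨h.1, frameLipschitzFnT_anti hh h.2.1, h.2.2⟩

/-- **The V14 thin step implies the V12-history thin step** (for `G.WF`): V14's (E3c) ranges over more comparison frames. -/
theorem twoLegCoreT_histV12_of_histV14 (hG : G.WF) {n : ℕ}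
    (h : TwoLegCoreT L M (histV14 L M G P Q R β U μ) G P Q R β U μ K n) :
    TwoLegCoreT L M (histV12 L M G P Q R β U μ) G P Q R β U μ K n :=
  twoLegCoreT_anti (fun _ _ hK' => histV14_of_histV12 hG hK') h

/-- **`TwoLegStepT hist ⇒ TwoLegCoreT hist`** (same history): the thin step is the T step minus tier 2 and the floor. -/
theorem twoLegCoreT_of_twoLegStepT {hist : TrigPolyC4v → ℕ → Prop} {n : ℕ} (h : TwoLegStepT L M hist G P Q R β U μ K n) :
    TwoLegCoreT L M hist G P Q R β U μ K n :=
  ⟨⟨h.1.1, h.1.2.1⟩, h.2.2.1, h.2.2.2⟩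

/-- The T1 sizes pair from the full (E3a-Fn) text (any `FrameFn`; e.g. `K.eval`, so `TwoLegStepT.sizes` feeds it). -/
theorem twoLegSizesT1Fn_of_twoLegSizesFn {f : FrameFn} {n : ℕ} (h : TwoLegSizesFn L M G Q R β U μ f n) : TwoLegSizesT1Fn L M G Q β U μ f n :=
  ⟨h.1, h.2.1⟩

end Bridge

end Summit.HubbardSuperconductivity.HubbardSuperconductivity.Theorems.KLRegimeSplit

end
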